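import Summits.HubbardSuperconductivity.HubbardSuperconductivity.Theses.VestigialChirality

/-!
# Birth skeleton (BC3) for the split piece `ChiralPointDWaveOrder` (stmt-HubbardSuperconductivity-14380)
# of `VestigialChirality.Target` — line `gc-window-passage` (crux-strategist cstrat-stmt-2416, 2026-08-17)

`ChiralPointDWaveOrder` = at ONE weak-coupling chiral point `(U, δ, μ)`: (a) grand-canonical density
matching, (b) Koma–Tasaki `d_{x²-y²}` order `HasDWaveOrder U μ`, (c) pair-chirality long-range order
`L⁻⁴⟨ψ, X_Lᴴ X_L ψ⟩ ≥ c` of EVERY normalised `(N_L, S^z = 0)`-sector ground state of the source-free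
CANONICAL torus model along even `L`.

The every-ground-state clause (c) is the delicate part (accidental sector degeneracies; canonical vs
grand-canonical).  This skeleton isolates it into two genuine stubs whose composition is kernel-checked:

* `stub_gcChiralWindow` (XL, constructive — the Pirogov–Sinai / cluster-expansion output in its
  NATURAL ensemble): a weak-coupling point with (a), (b) and (c′) EVERY GRAND-CANONICAL ground state
  `φ` of `K_{μ'} = H - μ'N` on the even `L`-torus is chiral, `⟨φ, X_Lᴴ X_L φ⟩ ≥ m L⁴`, UNIFORMLY for
  `μ'` in a window `[μ-ε, μ+ε]`, together with (e) EXPOSEDNESS of the canonical filling: for every large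
  even `L` some `μ'` in the window supports `N_L = 2⌊(1-δ)L²/2⌋` on the lower convex hull of
  `N ↦ E₀(N)` (`E₀(K_{μ'}) = E₀(H)|_{N_L} - μ' N_L`: no phase separation / negative compressibility
  at the chiral filling; even `N_L` dodges the pairing stagger).
* `stub_exposedSectorGroundIsGcGround` (M–L, TRUE for the SU(2)-invariant Hubbard Hamiltonian — Lieb
  1989 multiplet argument): if `N` is exposed at `μ'` then EVERY `(N, S^z = 0)`-sector ground state of
  `H` is a grand-canonical ground-state vector of `K_{μ'}`: the `S^z = 0` sector attains the `N`-particle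
  ground energy because every spin multiplet has an `S^z = 0` member, and `K_{μ'} ψ = (E₀(N) - μ'N) ψ`.
* `ChiralPointDWaveOrder_of` (sorry-free): the two stubs give the crux BY NAME — for an admissible
  sector ground-state sequence, at every large even `L` the state is a GC ground state at the exposed
  `μ' ∈ [μ-ε, μ+ε]`, hence chiral with the window's uniform `m`.

Why it dodges the every-GS risk named on the item: an accidental degeneracy of the sector ground
level with a non-chiral level is excluded in the GC ensemble by (c′) (all GC ground states in the
window are chiral) and transported to the canonical sector by convexity (e) + SU(2), instead of
being assumed away.  Probes: neither stub gives the crux or the summit cheaply (bc/ probes, report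
`Cruxes/Target/BC2-REDIRECT.md`).  Sources: KomaTasaki1994 §2; Lieb1989 (PRL 62, 1201: spin
multiplets / S^z = 0 representatives); Tasaki2020 §2.1, §9; DattaFernandezFrohlich1996,
BorgsKoteckyUeltschi1996 (quantum Pirogov–Sinai outputs are grand-canonical and uniform in μ-windows).
-/

set_option linter.dupNamespace false

namespace Summit.HubbardSuperconductivity.HubbardSuperconductivity.Cruxes.ChiralPointDWaveOrder.GcWindowPassage

open scoped BigOperators Matrix

/-- **S1 (construction, XL).** Grand-canonical chiral window at a weak-coupling point: density
matching (a), Koma–Tasaki d-wave order (b), every GC ground state of `K_{μ'}` chiral uniformly for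
`μ' ∈ [μ-ε, μ+ε]` (c′), and exposedness of the even canonical filling `N_L` inside the window (e). -/
theorem stub_gcChiralWindow :
    ∀ U₀ : ℝ, 0 < U₀ → ∃ U ∈ Set.Ioo (0 : ℝ) U₀, ∃ δ ∈ Set.Ioo (0 : ℝ) (1 / 2), ∃ μ ε m : ℝ, 0 < ε ∧ 0 < m ∧ Filter.Tendsto (fun L : ℕ => ((Literature.MathematicalPhysics.QuantumLattice.hubbardTorusWith 2 (L + 1) 1 U μ).groundStateFunctional Literature.MathematicalPhysics.QuantumLattice.totalNumber).re / ((L + 1 : ℕ) : ℝ) ^ 2) Filter.atTop (nhds (1 - δ)) ∧ Literature.MathematicalPhysics.QuantumLattice.HasDWaveOrder U μ ∧ ∃ L₀ : ℕ, ∀ (L : ℕ) [NeZero L], Even L → L₀ ≤ L → (∀ μ' ∈ Set.Icc (μ - ε) (μ + ε), ∀ φ : Literature.MathematicalPhysics.QuantumLattice.Fock (Literature.MathematicalPhysics.QuantumLattice.Orb (Literature.MathematicalPhysics.QuantumLattice.FermionTorus 2 L)), (Literature.MathematicalPhysics.QuantumLattice.hubbardTorusWith 2 L 1 U μ').IsGroundStateVector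 φ → star φ ⬝ᵥ φ = 1 → let B := fun (x : Literature.Probability.LatticeModels.TorusSite 2 L) (e : Literature.Probability.LatticeModels.Site 2) => Literature.MathematicalPhysics.QuantumLattice.annihilation (Literature.MathematicalPhysics.QuantumLattice.orb (Literature.MathematicalPhysics.QuantumLattice.FermionTorus.ofTorusSite x) 0) * Literature.MathematicalPhysics.QuantumLattice.annihilation (Literature.MathematicalPhysics.QuantumLattice.orb (Literature.MathematicalPhysics.QuantumLattice.FermionTorus.ofTorusSite (x + Literature.Probability.LatticeModels.Torus.proj L e)) 1) - Literature.MathematicalPhysics.QuantumLattice.annihilation (Literature.MathematicalPhysics.QuantumLattice.orb (Literature.MathematicalPhysics.QuantumLattice.FermionTorus.ofTorusSite x) 1) * Literature.MathematicalPhysics.QuantumLattice.annihilation (Literature.MathematicalPhysics.QuantumLattice.orb (Literature.MathematicalPhysics.QuantumLattice.FermionTorus.ofTorusSite (x + Literature.Probability.LatticeModels.Torus.proj L e)) 0); let P₂ := fun (x : Literature.Probability.LatticeModels.TorusSite 2 L) => ((1 / Real.sqrt 2 : ℝ) : ℂ) • (B x ![1, 1] + B x ![-1, -1] - B x ![1,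 -1] - B x ![-1, 1]); let P₁ := fun (x : Literature.Probability.LatticeModels.TorusSite 2 L) => Literature.MathematicalPhysics.QuantumLattice.localPair Literature.MathematicalPhysics.QuantumLattice.dWaveFormFactor L x; let X := ∑ x : Literature.Probability.LatticeModels.TorusSite 2 L, Complex.I • (Matrix.conjTranspose (P₁ x) * P₂ x - Matrix.conjTranspose (P₂ x) * P₁ x); m ≤ (Literature.MathematicalPhysics.QuantumLattice.expect (Matrix.conjTranspose X * X) φ).re / ((L : ℕ) : ℝ) ^ 4) ∧ (∃ μ' ∈ Set.Icc (μ - ε) (μ + ε), (Literature.MathematicalPhysics.QuantumLattice.hubbardTorusWith 2 L 1 U μ').groundEnergy = (Literature.MathematicalPhysics.QuantumLattice.hubbardTorus 2 L 1 U).minEnergyOn (Literature.MathematicalPhysics.QuantumLattice.nParticleSubmodule (2 * ⌊(1 - δ) * (L : ℝ) ^ 2 / 2⌋₊)) - μ' * (((2 * ⌊(1 - δ) * (L : ℝ) ^ 2 / 2⌋₊ : ℕ)) : ℝ)) := by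
  sorry

/-- **S2 (passage, M–L; true by SU(2)).** An exposed canonical sector's `(N, S^z = 0)` ground states
are grand-canonical ground-state vectors of `K_{μ'} = H - μ'N` (every spin multiplet has an `S^z = 0`
member, so the sector attains the `N`-particle ground energy; then `K_{μ'}ψ = E₀(K_{μ'})ψ`). -/
theorem stub_exposedSectorGroundIsGcGround :
    ∀ (L : ℕ) [NeZero L] (U μ' : ℝ) (N : ℕ) (ψ : Literature.MathematicalPhysics.QuantumLattice.Fock (Literature.MathematicalPhysics.QuantumLattice.Orb (Literature.MathematicalPhysics.QuantumLattice.FermionTorus 2 L))), (Literature.MathematicalPhysics.QuantumLattice.hubbardTorusWith 2 L 1 U μ').groundEnergy = (Literature.MathematicalPhysics.QuantumLattice.hubbardTorus 2 L 1 U).minEnergyOn (Literature.MathematicalPhysics.QuantumLattice.nParticleSubmodule N) - μ' * (N : ℝ) → Literature.MathematicalPhysics.QuantumLattice.IsGroundStateInSector (Literature.MathematicalPhysics.QuantumLattice.hubbardTorus 2 L 1 U) N 0 ψ → (Literature.MathematicalPhysics.QuantumLattice.hubbardTorusWith 2 L 1 U μ').IsGroundStateVector ψ := by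
  sorry

/-- **Composition (kernel-checked).** `S1 → S2 → ChiralPointDWaveOrder` BY NAME. -/
theorem ChiralPointDWaveOrder_of
    (h₁ : ∀ U₀ : ℝ, 0 < U₀ → ∃ U ∈ Set.Ioo (0 : ℝ) U₀, ∃ δ ∈ Set.Ioo (0 : ℝ) (1 / 2), ∃ μ ε m : ℝ, 0 < ε ∧ 0 < m ∧ Filter.Tendsto (fun L : ℕ => ((Literature.MathematicalPhysics.QuantumLattice.hubbardTorusWith 2 (L + 1) 1 U μ).groundStateFunctional Literature.MathematicalPhysics.QuantumLattice.totalNumber).re / ((L + 1 : ℕ) : ℝ) ^ 2) Filter.atTop (nhds (1 - δ)) ∧ Literature.MathematicalPhysics.QuantumLattice.HasDWaveOrder U μ ∧ ∃ L₀ : ℕ, ∀ (L : ℕ) [NeZero L], Even L → L₀ ≤ L → (∀ μ' ∈ Set.Icc (μ - ε) (μ + ε), ∀ φ : Literature.MathematicalPhysics.QuantumLattice.Fock (Literature.MathematicalPhysics.QuantumLattice.Orb (Literature.MathematicalPhysics.QuantumLattice.FermionTorus 2 L)), (Literature.MathematicalPhysics.QuantumLattice.hubbardTorusWith 2 L 1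 U μ').IsGroundStateVector φ → star φ ⬝ᵥ φ = 1 → let B := fun (x : Literature.Probability.LatticeModels.TorusSite 2 L) (e : Literature.Probability.LatticeModels.Site 2) => Literature.MathematicalPhysics.QuantumLattice.annihilation (Literature.MathematicalPhysics.QuantumLattice.orb (Literature.MathematicalPhysics.QuantumLattice.FermionTorus.ofTorusSite x) 0) * Literature.MathematicalPhysics.QuantumLattice.annihilation (Literature.MathematicalPhysics.QuantumLattice.orb (Literature.MathematicalPhysics.QuantumLattice.FermionTorus.ofTorusSite (x + Literature.Probability.LatticeModels.Torus.proj L e)) 1) - Literature.MathematicalPhysics.QuantumLattice.annihilation (Literature.MathematicalPhysics.QuantumLattice.orb (Literature.MathematicalPhysics.QuantumLattice.FermionTorus.ofTorusSite x) 1) * Literature.MathematicalPhysics.QuantumLattice.annihilation (Literature.MathematicalPhysics.QuantumLattice.orb (Literature.MathematicalPhysics.QuantumLattice.FermionTorus.ofTorusSite (x + Literature.Probability.LatticeModels.Torus.proj L e)) 0); let P₂ := fun (x : Literature.Probability.LatticeModels.TorusSite 2 L) => ((1 / Real.sqrt 2 : ℝ) : ℂ) • (B x ![1, 1] + B x ![-1,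 -1] - B x ![1, -1] - B x ![-1, 1]); let P₁ := fun (x : Literature.Probability.LatticeModels.TorusSite 2 L) => Literature.MathematicalPhysics.QuantumLattice.localPair Literature.MathematicalPhysics.QuantumLattice.dWaveFormFactor L x; let X := ∑ x : Literature.Probability.LatticeModels.TorusSite 2 L, Complex.I • (Matrix.conjTranspose (P₁ x) * P₂ x - Matrix.conjTranspose (P₂ x) * P₁ x); m ≤ (Literature.MathematicalPhysics.QuantumLattice.expect (Matrix.conjTranspose X * X) φ).re / ((L : ℕ) : ℝ) ^ 4) ∧ (∃ μ' ∈ Set.Icc (μ - ε) (μ + ε), (Literature.MathematicalPhysics.QuantumLattice.hubbardTorusWith 2 L 1 U μ').groundEnergy = (Literature.MathematicalPhysics.QuantumLattice.hubbardTorus 2 L 1 U).minEnergyOn (Literature.MathematicalPhysics.QuantumLattice.nParticleSubmodule (2 * ⌊(1 - δ) * (L : ℝ) ^ 2 / 2⌋₊)) - μ' * (((2 * ⌊(1 - δ) * (L : ℝ) ^ 2 / 2⌋₊ : ℕ)) : ℝ)))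
    (h₂ : ∀ (L : ℕ) [NeZero L] (U μ' : ℝ) (N : ℕ) (ψ : Literature.MathematicalPhysics.QuantumLattice.Fock (Literature.MathematicalPhysics.QuantumLattice.Orb (Literature.MathematicalPhysics.QuantumLattice.FermionTorus 2 L))), (Literature.MathematicalPhysics.QuantumLattice.hubbardTorusWith 2 L 1 U μ').groundEnergy = (Literature.MathematicalPhysics.QuantumLattice.hubbardTorus 2 L 1 U).minEnergyOn (Literature.MathematicalPhysics.QuantumLattice.nParticleSubmodule N) - μ' * (N : ℝ) → Literature.MathematicalPhysics.QuantumLattice.IsGroundStateInSector (Literature.MathematicalPhysics.QuantumLattice.hubbardTorus 2 L 1 U) N 0 ψ → (Literature.MathematicalPhysics.QuantumLattice.hubbardTorusWith 2 L 1 U μ').IsGroundStateVector ψ) :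
    Summit.HubbardSuperconductivity.HubbardSuperconductivity.Theses.VestigialChirality.ChiralPointDWaveOrder := by
  intro U₀ hU₀
  obtain ⟨U, hU, δ, hδ, μ, ε, m, _hε, hm, hdens, hord, L₀, hwin⟩ := h₁ U₀ hU₀
  refine ⟨U, hU, δ, hδ, μ, m, hm, hdens, hord, fun N ψ hyp => ⟨L₀, ?_⟩⟩
  intro L _ hL hL₀
  obtain ⟨hchi, μ', hμ', hexp⟩ := hwin L hL hL₀
  obtain ⟨hN, hnorm, hgs⟩ := hyp L hL
  have hgc : (Literature.MathematicalPhysics.QuantumLattice.hubbardTorusWith 2 L 1 U μ').IsGroundStateVector (ψ L) := by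
    refine h₂ L U μ' (N L) (ψ L) ?_ hgs
    rw [hN]; exact hexp
  exact hchi μ' hμ' (ψ L) hgc hnorm

end Summit.HubbardSuperconductivity.HubbardSuperconductivity.Cruxes.ChiralPointDWaveOrder.GcWindowPassage
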